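import Literature.Probability.LatticeModels.RandomClusterRimWiring
import Literature.Probability.LatticeModels.RandomClusterFKG
import HarnessLib

/-!
# Domain Markov property with the rim wired from outside — version with a FAR wired set `B`

Topic `Literature/Probability/LatticeModels` (trunk `StatMech`, family `crit-ising`). Generalisation of
`RandomClusterRimWiring.lean` (the case `B = ∅`) to a random-cluster measure `φ^B_{G,p,q}` whose wired set `B`
lies FAR from the region: no vertex of `B` is incident to an edge of the region `U` (`B ∩ X = ∅`). This is the
situation at the second and later levels of Kesten's decomposition (H. Kesten, PTRF 73 (1986), proof of Thm. 3):
inside an outer open circuit `γ₀` (wired, `B = V(γ₀)`) one conditions on the next outermost open circuit `γ` and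
on everything between `γ` and `γ₀`; the configuration enclosed by `γ` is then the random-cluster configuration
of the enclosed region with `γ` wired — the far wiring of `γ₀` only merges clusters that do not meet the inside.
Hypotheses as in the free case — `U` lives on `X`, the open edges `ζ₀` off `U` touch `X` only at the rim `W`,
`W` is one cluster of the OUTSIDE graph `⟨ζ₀⟩ ∨ K_B` — plus `B ∩ X = ∅`. Then for every event `A`,

  `φ^B_{G,p,q}({ω ∩ U ∈ A} ∩ {ω ∖ U = ζ₀}) = φ^B_{G,p,q}({ω ∖ U = ζ₀}) · φ^W_{⟨U⟩,p,q}(A)`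

(`rcMeasure_real_inter_cylinder_eq_mul_fromEdgeSet_rim_wired`). The combinatorial identity is
`clusterCount_union_add_eq_wired`: `k^B(a ∪ ζ₀) + k^W(∅) = k^B(ζ₀) + k^W(a)` for inside configurations `a`.
Everything is proved; no definitions, no named facts.

## References

* G. Grimmett, *The Random-Cluster Model*, Springer (2006): §4.2, eqs. (4.11)–(4.13), Lemma (4.13).
* H. Kesten, The incipient infinite cluster in two-dimensional percolation, *Probab. Theory Related
  Fields* 73 (1986) 369–394: proof of Thm. 3 (conditioning on the outermost open circuit).
-/

noncomputable section

open MeasureTheory Finset SimpleGraph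

namespace Literature.Probability.LatticeModels

/-! ### Reachability: outside-open excursions versus the wiring of the rim -/

section Reach

variable {V : Type*}

/-- **An outside excursion is a rim-to-rim jump (far wired set `B`).** Let the inside edges `a` have both
endpoints in `X`, every endpoint in `X` of an outside edge of `ξ` lie in the rim `W`, and `B ∩ X = ∅`. Then two
vertices of `X` joined in `⟨a⟩ ∨ ⟨ξ⟩ ∨ K_B` are joined in `⟨a⟩ ∨ K_W`: along a walk, each maximal run of
outside steps (`ξ`-edges and `K_B`-jumps) starts and ends at rim vertices. [cite: Grimmett2006, §4.2, Lemma (4.13)] -/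
theorem reachable_sup_wired_of_reachable_sup_fromEdgeSet_sup_wired {a ξ : Set (Sym2 V)} {B W X : Set V}
    (haX : ∀ e ∈ a, ∀ x ∈ e, x ∈ X) (hξ : ∀ e ∈ ξ, ∀ x ∈ e, x ∈ X → x ∈ W) (hBX : ∀ b ∈ B, b ∉ X)
    {u v : V} (hu : u ∈ X) (hv : v ∈ X) (h : (fromEdgeSet a ⊔ (fromEdgeSet ξ ⊔ wired B)).Reachable u v) :
    (fromEdgeSet a ⊔ wired W).Reachable u v := by
  obtain ⟨p⟩ := h
  have hKW : ∀ {s t : V}, s ∈ W → t ∈ W → (fromEdgeSet a ⊔ wired W).Reachable s t := by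
    intro s t hs ht
    by_cases hst : s = t
    · subst hst; exact Reachable.refl _
    · exact Adj.reachable (Or.inr (by rw [wired_adj]; exact ⟨hst, hs, ht⟩))
  -- invariant along a walk towards a vertex of `X`
  suffices H : ∀ {x y : V} (_ : (fromEdgeSet a ⊔ (fromEdgeSet ξ ⊔ wired B)).Walk x y), y ∈ X →
      (x ∈ X → (fromEdgeSet a ⊔ wired W).Reachable x y) ∧
      (x ∉ X → ∃ w ∈ W, (fromEdgeSet ξ ⊔ wired B).Reachable x w ∧
        (fromEdgeSet a ⊔ wired W).Reachable w y) from
    (H p hv).1 hu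
  intro x y q
  induction q with
  | nil => exact fun hy => ⟨fun _ => Reachable.refl _, fun hx => absurd hy hx⟩
  | @cons x x₁ z hxx₁ q ih =>
    intro hz
    have ih := ih hz
    rw [sup_adj] at hxx₁
    rcases hxx₁ with hA | hΞ
    · -- an inside edge: both endpoints in `X`
      have hmem := ((fromEdgeSet_adj _).1 hA).1
      have hx : x ∈ X := haX _ hmem x (Sym2.mem_mk_left x x₁)
      have hx₁ : x₁ ∈ X := haX _ hmem x₁ (Sym2.mem_mk_right x x₁)
      refine ⟨fun _ => ?_, fun hx' => absurd hx hx'⟩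
      have h1 : (fromEdgeSet a ⊔ wired W).Adj x x₁ := Or.inl hA
      exact h1.reachable.trans (ih.1 hx₁)
    · -- an outside edge or a far wiring jump: its endpoints in `X` are rim vertices
      have hends : (x ∈ X → x ∈ W) ∧ (x₁ ∈ X → x₁ ∈ W) := by
        rcases hΞ with hΞ | hΞ
        · have hmem := ((fromEdgeSet_adj _).1 hΞ).1
          exact ⟨hξ _ hmem x (Sym2.mem_mk_left x x₁), hξ _ hmem x₁ (Sym2.mem_mk_right x x₁)⟩
        · rw [wired_adj] at hΞ
          exact ⟨fun hx => absurd hx (hBX x hΞ.2.1), fun hx₁ => absurd hx₁ (hBX x₁ hΞ.2.2)⟩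
      obtain ⟨hxW, hx₁W⟩ := hends
      have hξxx₁ : (fromEdgeSet ξ ⊔ wired B).Reachable x x₁ := hΞ.reachable
      by_cases hx₁ : x₁ ∈ X
      · have ih1 := ih.1 hx₁
        refine ⟨fun hx => (hKW (hxW hx) (hx₁W hx₁)).trans ih1, fun _ => ⟨x₁, hx₁W hx₁, hξxx₁, ih1⟩⟩
      · obtain ⟨w, hw, hx₁w, hwv⟩ := ih.2 hx₁
        exact ⟨fun hx => (hKW (hxW hx) hw).trans hwv, fun _ => ⟨w, hw, hξxx₁.trans hx₁w, hwv⟩⟩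

/-- **A rim jump is an outside excursion (far wired set `B`).** If any two rim vertices are joined in
`⟨ξ⟩ ∨ K_B`, then `⟨a⟩ ∨ K_W`-reachability implies `⟨a⟩ ∨ ⟨ξ⟩ ∨ K_B`-reachability. [cite: Grimmett2006, §4.2, Lemma (4.13)] -/
theorem reachable_sup_fromEdgeSet_sup_wired_of_reachable_sup_wired {a ξ : Set (Sym2 V)} {B W : Set V}
    (hW : ∀ x ∈ W, ∀ y ∈ W, (fromEdgeSet ξ ⊔ wired B).Reachable x y)
    {u v : V} (h : (fromEdgeSet a ⊔ wired W).Reachable u v) :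
    (fromEdgeSet a ⊔ (fromEdgeSet ξ ⊔ wired B)).Reachable u v := by
  refine reachable_of_adj_imp_reachable (fun s t hst => ?_) h
  rcases hst with hst | hst
  · exact Adj.reachable (Or.inl hst : (fromEdgeSet a ⊔ (fromEdgeSet ξ ⊔ wired B)).Adj s t)
  · rw [wired_adj] at hst
    obtain ⟨-, hs, ht⟩ := hst
    exact (hW s hs t ht).mono le_sup_right

/-- The two reachability relations agree on `X` (far wired set `B`). [cite: Grimmett2006, §4.2, Lemma (4.13)] -/
theorem reachable_sup_wired_iff_wired {a ξ : Set (Sym2 V)} {B W X : Set V}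
    (haX : ∀ e ∈ a, ∀ x ∈ e, x ∈ X) (hξ : ∀ e ∈ ξ, ∀ x ∈ e, x ∈ X → x ∈ W) (hBX : ∀ b ∈ B, b ∉ X)
    (hW : ∀ x ∈ W, ∀ y ∈ W, (fromEdgeSet ξ ⊔ wired B).Reachable x y)
    {u v : V} (hu : u ∈ X) (hv : v ∈ X) :
    (fromEdgeSet a ⊔ (fromEdgeSet ξ ⊔ wired B)).Reachable u v ↔ (fromEdgeSet a ⊔ wired W).Reachable u v :=
  ⟨reachable_sup_wired_of_reachable_sup_fromEdgeSet_sup_wired haX hξ hBX hu hv,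
    reachable_sup_fromEdgeSet_sup_wired_of_reachable_sup_wired hW⟩

end Reach

/-! ### The cluster-count identity -/

section ClusterCount

variable {V : Type*} [Finite V]

/-- **Cluster counts with the rim wired from outside, far wired set `B`.** For inside edges `a` on `X`,
outside open edges `ξ` touching `X` only at the rim `W`, `B ∩ X = ∅`, and `W` one cluster of `⟨ξ⟩ ∨ K_B`:
`k^B(a ∪ ξ) + k^W(∅) = k^B(ξ) + k^W(a)` (induction on `a`: a new inside edge merges two clusters on the left
iff it does on the right, `reachable_sup_wired_iff_wired`). [cite: Grimmett2006, §4.2, Lemma (4.13)] -/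
theorem clusterCount_union_add_eq_wired (a : Finset (Sym2 V)) (ξ : Set (Sym2 V)) {B W X : Set V}
    (haX : ∀ e ∈ a, ∀ x ∈ e, x ∈ X) (hξ : ∀ e ∈ ξ, ∀ x ∈ e, x ∈ X → x ∈ W) (hBX : ∀ b ∈ B, b ∉ X)
    (hW : ∀ x ∈ W, ∀ y ∈ W, (fromEdgeSet ξ ⊔ wired B).Reachable x y) :
    clusterCount ((↑a : Set (Sym2 V)) ∪ ξ) B + clusterCount (∅ : Percolation.BondConfig V) W =
      clusterCount ξ B + clusterCount (↑a : Percolation.BondConfig V) W := by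
  classical
  induction a using Finset.induction_on with
  | empty => simp [clusterCount, Percolation.openGraph]
  | insert e a hea ih =>
    have haX' : ∀ e ∈ a, ∀ x ∈ e, x ∈ X := fun e' he' => haX e' (Finset.mem_insert_of_mem he')
    have ih' := ih haX'
    induction e using Sym2.ind with
    | h u v =>
      have hu : u ∈ X := haX _ (Finset.mem_insert_self _ _) u (Sym2.mem_mk_left u v)
      have hv : v ∈ X := haX _ (Finset.mem_insert_self _ _) v (Sym2.mem_mk_right u v)
      -- the graphs after inserting the edge `uv`
      have h1 : fromEdgeSet ((↑(insert s(u, v) a) : Set (Sym2 V)) ∪ ξ) ⊔ wired B =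
          (fromEdgeSet (↑a : Set (Sym2 V)) ⊔ (fromEdgeSet ξ ⊔ wired B)) ⊔ edge u v := by
        rw [Finset.coe_insert, Set.insert_union, Set.insert_eq, fromEdgeSet_union, fromEdgeSet_union]
        have he : fromEdgeSet ({s(u, v)} : Set (Sym2 V)) = edge u v := rfl
        rw [he]
        ac_rfl
      have h0 : fromEdgeSet ((↑a : Set (Sym2 V)) ∪ ξ) ⊔ wired B =
          fromEdgeSet (↑a : Set (Sym2 V)) ⊔ (fromEdgeSet ξ ⊔ wired B) := by
        rw [fromEdgeSet_union, sup_assoc]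
      have h2 : fromEdgeSet (↑(insert s(u, v) a) : Set (Sym2 V)) ⊔ wired W =
          (fromEdgeSet (↑a : Set (Sym2 V)) ⊔ wired W) ⊔ edge u v := by
        rw [Finset.coe_insert, Set.insert_eq, fromEdgeSet_union, sup_comm (fromEdgeSet {s(u, v)}),
          sup_right_comm]
        rfl
      unfold clusterCount Percolation.openGraph at ih' ⊢
      rw [h1, h2]
      rw [h0] at ih'
      set K₁ : SimpleGraph V := fromEdgeSet (↑a : Set (Sym2 V)) ⊔ (fromEdgeSet ξ ⊔ wired B) with hK₁
      set K₂ : SimpleGraph V := fromEdgeSet (↑a : Set (Sym2 V)) ⊔ wired W with hK₂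
      have hiff : K₁.Reachable u v ↔ K₂.Reachable u v :=
        reachable_sup_wired_iff_wired (fun e' he' => haX' e' (Finset.mem_coe.1 he')) hξ hBX hW hu hv
      by_cases huv : K₁.Reachable u v
      · rw [card_connectedComponent_sup_edge_of_reachable K₁ huv,
          card_connectedComponent_sup_edge_of_reachable K₂ (hiff.1 huv)]
        exact ih'
      · have huv' : ¬K₂.Reachable u v := fun h => huv (hiff.2 h)
        have l1 := card_connectedComponent_sup_edge_lt K₁ huv
        have l1' := card_connectedComponent_le_sup_edge_add_one K₁ u v
        have l2 := card_connectedComponent_sup_edge_lt K₂ huv'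
        have l2' := card_connectedComponent_le_sup_edge_add_one K₂ u v
        omega

end ClusterCount

/-! ### Weights and the exact conditional law -/

section Finite

variable {V : Type*} [Fintype V] [DecidableEq V] (G : SimpleGraph V) [DecidableRel G.Adj]

/-- **Weights factorise when the rim is wired from outside (far wired set `B`).** For a region `U ⊆ E(G)`
on the vertex set `X`, a configuration `ζ₀ ⊆ E(G) ∖ U` touching `X` only at the rim `W`, `B ∩ X = ∅`, `W` one
cluster of `⟨ζ₀⟩ ∨ K_B`, and `η ⊆ U`:
`w^B_G(η ∪ ζ₀) · q^{k^W(∅)} = p^{|ζ₀|} (1 - p)^{|E(G) ∖ U| - |ζ₀|} q^{k^B(ζ₀)} · w^W_{⟨U⟩}(η)`.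
[cite: Grimmett2006, §4.2 eq. (4.12) and Lemma (4.13)] -/
theorem rcWeight_union_mul_eq_mul_rcWeight_fromEdgeSet_rim_wired (p q : ℝ) {B W X : Set V}
    {U ζ₀ η : Finset (Sym2 V)} (hU : U ⊆ G.edgeFinset) (hζ₀ : ζ₀ ⊆ G.edgeFinset \ U) (hη : η ⊆ U)
    (hUX : ∀ e ∈ U, ∀ x ∈ e, x ∈ X) (hζX : ∀ e ∈ ζ₀, ∀ x ∈ e, x ∈ X → x ∈ W) (hBX : ∀ b ∈ B, b ∉ X)
    (hW : ∀ x ∈ W, ∀ y ∈ W, (fromEdgeSet (ζ₀ : Set (Sym2 V)) ⊔ wired B).Reachable x y) :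
    rcWeight G p q B (η ∪ ζ₀) * q ^ clusterCount (∅ : Percolation.BondConfig V) W =
      p ^ #ζ₀ * (1 - p) ^ (#(G.edgeFinset \ U) - #ζ₀) *
        q ^ clusterCount (↑ζ₀ : Percolation.BondConfig V) B *
        rcWeight (fromEdgeSet (U : Set (Sym2 V))) p q W η := by
  have hEU : ∀ i : Fintype (fromEdgeSet (U : Set (Sym2 V))).edgeSet,
      @SimpleGraph.edgeFinset V (fromEdgeSet (U : Set (Sym2 V))) i = U := fun i ↦
    @edgeFinset_fromEdgeSet_of_subset V _ G _ U hU i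
  have hζ₀U : Disjoint ζ₀ U := Finset.disjoint_of_subset_left hζ₀ sdiff_disjoint
  have hηζ : Disjoint η ζ₀ := Finset.disjoint_of_subset_left hη hζ₀U.symm
  -- cardinalities
  have hcard₁ : #(η ∪ ζ₀) = #η + #ζ₀ := card_union_of_disjoint hηζ
  have hsplit : G.edgeFinset \ (η ∪ ζ₀) = (U \ η) ∪ ((G.edgeFinset \ U) \ ζ₀) := by
    ext e
    simp only [mem_sdiff, mem_union, not_or]
    constructor
    · rintro ⟨heE, heη, heζ⟩
      by_cases heU : e ∈ U
      · exact Or.inl ⟨heU, heη⟩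
      · exact Or.inr ⟨⟨heE, heU⟩, heζ⟩
    · rintro (⟨heU, heη⟩ | ⟨⟨heE, heU⟩, heζ⟩)
      · exact ⟨hU heU, heη, fun h ↦ (Finset.disjoint_left.1 hζ₀U h) heU⟩
      · exact ⟨heE, fun h ↦ heU (hη h), heζ⟩
  have hdisj : Disjoint (U \ η) ((G.edgeFinset \ U) \ ζ₀) :=
    Finset.disjoint_of_subset_left sdiff_subset
      (Finset.disjoint_of_subset_right sdiff_subset disjoint_sdiff)
  have hcard₂ : #(G.edgeFinset \ (η ∪ ζ₀)) = #(U \ η) + (#(G.edgeFinset \ U) - #ζ₀) := by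
    rw [hsplit, card_union_of_disjoint hdisj, card_sdiff_of_subset hζ₀]
  -- cluster counts
  have hk : clusterCount (↑(η ∪ ζ₀) : Percolation.BondConfig V) B +
      clusterCount (∅ : Percolation.BondConfig V) W =
      clusterCount (↑ζ₀ : Percolation.BondConfig V) B + clusterCount (↑η : Percolation.BondConfig V) W := by
    rw [Finset.coe_union]
    exact clusterCount_union_add_eq_wired η (↑ζ₀) (fun e he ↦ hUX e (hη he))
      (fun e he x hx ↦ hζX e (Finset.mem_coe.1 he) x hx) hBX hW
  have hq : q ^ clusterCount (↑(η ∪ ζ₀) : Percolation.BondConfig V) B *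
      q ^ clusterCount (∅ : Percolation.BondConfig V) W =
      q ^ clusterCount (↑ζ₀ : Percolation.BondConfig V) B *
        q ^ clusterCount (↑η : Percolation.BondConfig V) W := by
    rw [← pow_add, ← pow_add, hk]
  simp only [rcWeight, hEU, hcard₁, hcard₂, pow_add]
  calc p ^ #η * p ^ #ζ₀ * ((1 - p) ^ #(U \ η) * (1 - p) ^ (#(G.edgeFinset \ U) - #ζ₀)) *
        q ^ clusterCount (↑(η ∪ ζ₀) : Percolation.BondConfig V) B *
        q ^ clusterCount (∅ : Percolation.BondConfig V) W
      = p ^ #η * p ^ #ζ₀ * ((1 - p) ^ #(U \ η) * (1 - p) ^ (#(G.edgeFinset \ U) - #ζ₀)) *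
        (q ^ clusterCount (↑(η ∪ ζ₀) : Percolation.BondConfig V) B *
        q ^ clusterCount (∅ : Percolation.BondConfig V) W) := by ring
    _ = p ^ #η * p ^ #ζ₀ * ((1 - p) ^ #(U \ η) * (1 - p) ^ (#(G.edgeFinset \ U) - #ζ₀)) *
        (q ^ clusterCount (↑ζ₀ : Percolation.BondConfig V) B *
        q ^ clusterCount (↑η : Percolation.BondConfig V) W) := by rw [hq]
    _ = _ := by ring

/-- **Domain Markov property with the rim wired from outside, far wired set `B`, exact form**
(Grimmett 2006, Lemma (4.13); Kesten 1986, proof of Thm. 3, second and later circuits: inside the wired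
outer circuit `B`, conditionally on the next outermost open circuit and everything between, the enclosed
configuration is the random-cluster configuration of the enclosed region with the circuit wired). Let
`U ⊆ E(G)` be a region all of whose edges have both endpoints in `X`, `B ∩ X = ∅`, `ζ₀ ⊆ E(G) ∖ U` a
configuration off the region whose edges touch `X` only at vertices of the rim `W`, and suppose any two
vertices of `W` are joined in `⟨ζ₀⟩ ∨ K_B`. Then for EVERY event `A`,
`φ^B_{G,p,q}({ω ∩ U ∈ A} ∩ {ω ∖ U = ζ₀}) = φ^B_{G,p,q}({ω ∖ U = ζ₀}) · φ^W_{⟨U⟩,p,q}(A)`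
(`0 ≤ p ≤ 1`, `q > 0`). [cite: Grimmett2006, Lemma (4.13)] -/
theorem rcMeasure_real_inter_cylinder_eq_mul_fromEdgeSet_rim_wired {p q : ℝ}
    (hp : p ∈ Set.Icc (0 : ℝ) 1) (hq : 0 < q) {B W X : Set V} (U : Finset (Sym2 V))
    (hU : U ⊆ G.edgeFinset) {ζ₀ : Finset (Sym2 V)} (hζ₀ : ζ₀ ⊆ G.edgeFinset \ U)
    (hUX : ∀ e ∈ U, ∀ x ∈ e, x ∈ X) (hζX : ∀ e ∈ ζ₀, ∀ x ∈ e, x ∈ X → x ∈ W) (hBX : ∀ b ∈ B, b ∉ X)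
    (hW : ∀ x ∈ W, ∀ y ∈ W, (fromEdgeSet (ζ₀ : Set (Sym2 V)) ⊔ wired B).Reachable x y)
    (A : Set (Percolation.BondConfig V)) :
    (rcMeasure G p q B).real ({ω | ω ∩ ↑U ∈ A} ∩ {ω | ω ∩ (↑U : Set (Sym2 V))ᶜ = ↑ζ₀}) =
      (rcMeasure G p q B).real {ω | ω ∩ (↑U : Set (Sym2 V))ᶜ = ↑ζ₀} *
        (rcMeasure (fromEdgeSet (U : Set (Sym2 V))) p q W).real A := by
  classical
  have hZ := rcPartitionFunction_pos G hp hq B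
  set GU : SimpleGraph V := fromEdgeSet (U : Set (Sym2 V)) with hGU
  have hEU : ∀ i : Fintype GU.edgeSet, @SimpleGraph.edgeFinset V GU i = U := fun i ↦
    @edgeFinset_fromEdgeSet_of_subset V _ G _ U hU i
  haveI : IsProbabilityMeasure (rcMeasure GU p q W) := isProbabilityMeasure_rcMeasure GU hp hq W
  have hqW : 0 < q ^ clusterCount (∅ : Percolation.BondConfig V) W := pow_pos hq _
  set c : ℝ := p ^ #ζ₀ * (1 - p) ^ (#(G.edgeFinset \ U) - #ζ₀) *
    q ^ clusterCount (↑ζ₀ : Percolation.BondConfig V) B /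
    q ^ clusterCount (∅ : Percolation.BondConfig V) W with hc
  have hweight : ∀ η : Finset (Sym2 V), η ⊆ U →
      rcWeight G p q B (η ∪ ζ₀) = c * rcWeight GU p q W η := by
    intro η hη
    have h := rcWeight_union_mul_eq_mul_rcWeight_fromEdgeSet_rim_wired G p q hU hζ₀ hη hUX hζX hBX hW
    rw [hc]
    field_simp
    linarith [h]
  -- `Z_G φ_G({ω ∩ U ∈ A'} ∩ {ω ∖ U = ζ₀}) = c · Z^W_U φ^W_U(A')`
  have key : ∀ A' : Set (Percolation.BondConfig V), rcPartitionFunction G p q B *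
      (rcMeasure G p q B).real ({ω | ω ∩ ↑U ∈ A'} ∩ {ω | ω ∩ (↑U : Set (Sym2 V))ᶜ = ↑ζ₀}) =
      c * (rcPartitionFunction GU p q W * (rcMeasure GU p q W).real A') := by
    intro A'
    rw [rcPartitionFunction_mul_real_inter_cylinder G hp hq B hU hζ₀ A']
    have h2 : rcPartitionFunction GU p q W * (rcMeasure GU p q W).real A' =
        ∑ η ∈ U.powerset, rcWeight GU p q W η *
          (if (↑η : Percolation.BondConfig V) ∈ A' then 1 else 0) := by
      rw [rcMeasure_real_apply GU hp hq W A', Finset.mul_sum, hEU]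
      refine Finset.sum_congr rfl fun η _ ↦ ?_
      have hZU := (rcPartitionFunction_pos GU hp hq W).ne'
      split_ifs
      · field_simp
      · simp
    rw [h2, Finset.mul_sum]
    refine Finset.sum_congr rfl fun η hη ↦ ?_
    rw [hweight η (Finset.mem_powerset.1 hη)]
    ring
  have k1 := key A
  have k2 := key Set.univ
  simp only [Set.mem_univ, Set.setOf_true, Set.univ_inter, probReal_univ, mul_one] at k2
  apply mul_left_cancel₀ hZ.ne'
  rw [k1, ← mul_assoc (rcPartitionFunction G p q B), k2]
  ring

end Finite

end Literature.Probability.LatticeModels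

end
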